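import Mathlib.Analysis.Normed.Module.Convex
import Summits.CriticalPhenomena.SAWScalingLimit.Theorems.SAWDevelopingMapObservableToSLECanonicalTransferDictionary

-- STATUS (line bridge-gate-renewal, stub 5 `stub_carvedToSLE`, 2026-08-16): rc 0, 0 sorries,
-- 0 warnings; companion work/stubs/stub_carvedToSLE_walks.lean (walk level).  CHECKED / NOT HERE:
-- see the module docstring (`## Listed`); the stub itself is OPEN — no `theorem stub_carvedToSLE`.

/-!
# Carved-domain dictionary for the stub `stub_carvedToSLE` (line `bridge-gate-renewal` of the crux
`SAWDefectDecoherence.ObservableToSLER`, stmt-CriticalPhenomena-14005): audit, carved vertex set,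
`R6`'s clauses, clean windows

Landing target:
`Summits/CriticalPhenomena/SAWScalingLimit/Theorems/SAWDefectDecoherenceObservableToSLERCarvedDictionary.lean`
(`--supports stmt-CriticalPhenomena-14005`).  Companion (no import either way):
`…ObservableToSLERCarvedDictionaryWalks.lean` (the bijection carved vertex walks ≃ mid-edge walks,
carved weight / law = Duminil-Copin–Smirnov partition sums / law, gate bookkeeping on lists).

The registered stub `stub_carvedToSLE : GateDecomposition → HexObservableLimitR6 → HexTight →
SLELawContinuity → CarvedToSLE` (skeleton `Cruxes/ObservableToSLER/Lines/bridge-gate-renewal.lean`)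
is OPEN (Conjecture-2-class identification).  This file and its companion are the AUDIT-BY-LEAN of
its conclusion `CarvedToSLE` as the INTERFACE to `R6`.  `CarvedToSLE` speaks `HexSAW.lean` (the
carved law `carvedLaw Ω δ (S ∪ T) q q'`: VERTEX self-avoiding walks of `Ω_δ = hexDomainGraph Ω δ` —
segment condition, largest component — from `q` to `q'` avoiding the two root sides); `R6` speaks
`HexParafermion.lean` (vertex domains `Λ : Finset HexVertex`, MID-EDGE walks `HexMidEdgeSAW Λ a b` on
ALL honeycomb edges inside `Λ`, boundary mid-edges, exact half-lattice balls).  Dictionary: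

* `Λ δ := carvedVerts (hexDomainGraph Ω δ) (S ∪ T) q` — vertices joined to `q` in `Ω_δ` avoiding
  `S ∪ T`; finite (`finite_carvedVerts`); a walk from `q` avoids `S ∪ T` iff it stays in it
  (`forall_mem_support_not_mem_iff`) — the hypotheses `hΛ`, `hΛS` of the companion's carved cells;
* `a δ := s(q, p)`, `b δ := s(q', p')` (`q ∈ Λ δ ∌ p, p'` by `self_mem_carvedVerts`,
  `not_mem_of_mem_carvedVerts`); boundary mid-edges, bijection, weights, `Nonempty`: companion file;
* `(hexGraph.induce (Λ δ)).Preconnected`: `preconnected_induce_of_carved` (unconditional);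
  `∀ v ∈ Λ δ, δ c_v ∈ Ω`: `smul_hexCenter_mem_of_carved`; new root `q ∈ embMeshDomain`:
  `mem_embMeshDomain_of_drop_head`;
* `k i`, `m i δ` (exact half-lattice clause): `HasCleanWindow Ω δ ρ S p q` says that in the ball
  `B(δ c_q, ρ) ⊆ Ω` membership in `S` is `rowOf k · ≤ rowOf k p`; for ANY row function `row` (so
  for all six `rowOf k`; orientation facts belong to the line's orientation API) the carved set
  satisfies in the ball `v ∈ Λ δ ↔ row p + 1 ≤ row v` (`mem_carvedVerts_iff_of_window`) — `R6`'s
  clause with `k i :=` the window's `k`, `m i δ := rowOf (k i) p + 1` — the easy direction outright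
  (`row_lt_of_mem_carvedVerts`), the hard one REDUCED to the pure honeycomb statement "the lattice
  half-ball `{row ≥ row p + 1} ∩ B` is joined to `q` inside itself" (hypothesis `hlat`); the
  analytic part (a honeycomb walk in a ball of `Ω` from a vertex of `Ω_δ` is a walk of `Ω_δ`) is
  `exists_walk_of_ball`, `embDomainGraph_adj_of_mem_of_adj`.

## Audit of the four announced mismatch types

(i) WEIGHTS / VERTEX SETS — NO MISMATCH.  The companion's bijection preserves the vertex list, so
`x_c^{vertexCount} = x_c^{length}` termwise (no constant, no one-step shift: the mid-edge walk
`s(p,q) → s(q',p')` visits exactly `q, …, q'`); the spin factor is not in the law.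

(ii) EDGE SETS — A REAL GAP, NOT A MIS-STATEMENT.  `Ω_δ` drops the honeycomb edges whose rescaled
segment leaves `closure Ω`; `HexMidEdgeSAW Λ` keeps all honeycomb edges inside `Λ`.  They differ at
every mesh near inward cusps of `∂D` and by `O(1)` edges near every reflex corner of a polygonal `D`,
and the carved domains inherit these features away from the cuts (refuter's
`Cruxes/ObservableToSLER/NegativeNote-CarvedToSLE.md`, item 1); so the no-bad-edge hypothesis of
the bijection is not dischargeable in general, and then the carved law is not literally a DCS law of
any vertex domain.  This cannot be repaired inside `CarvedToSLE`: its law is forced by the cell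
structure (`GateDecomposition`; stub 6 consumes exactly this law, for EVERY Dobrushin domain); an
`IsHArc`-type edge filter (`Theorems/SAWDevelopingMapHexTightReversalDefs.lean`) would have to sit
on `R6`'s side (re-typing `R6` over edge-filtered domains — a route decision which makes stub 3,
`R → R6`, strictly harder: `R`, item 14003, speaks of full vertex domains only).  Inside the stub the
gap is paid as the sibling crux 10472 pays the canonical-vs-admissible gap: trimmed admissible
families, the sandwich
`Z_{Λ^in} ≤ Z^{carved} ≤ Z_{Λ^out}` and boundary insensitivity `Z_{Λ'}/Z_Λ → 1`
(`Theorems/SAWDevelopingMapObservableToSLECanonicalTransfer{Sandwich,Insensitivity,Squeeze}.lean`);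
`R6`'s compact-exhaustion clause leaves room for the trimming.  Same for `hexDomainSimplyConnected`
(fails when `ℂ ∖ Ω` has slivers thinner than the mesh; note's item 2).

(iii) ORIENTATION AT THE TARGET GATE — NO MISMATCH.  `R6` treats its two marked points alike
(`∀ i : Fin 2`); at the target the clean window of the REVERSED list is `HasCleanWindow Ω δ ρ T p' q'`
(root side `T ∋ p'`, new root `q'`), and `mem_carvedVerts_iff_of_window` gives there
`v ∈ Λ δ ↔ rowOf k' p' + 1 ≤ rowOf k' v`: `k 1 := k'`, `m 1 δ := rowOf k' p' + 1`, the carved domain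
on the side where `rowOf k'` increases = the side `ζ^{k'}·i` of the gate line = `R6`'s flat clause
(consistency of `rowOf k` with `ζ^k·i`: refuter's `DrefuteSummary-bridge-gate-renewal.md`, and the
line's registered `stub_orientationConsistency`).  The walk's crossing direction is irrelevant.

(iv) SUFFIX / REVERSAL CONVENTIONS — NO MISMATCH (companion, `gate_indices_reverse`,
`gate_list_decomposition`): `IsFirstExit (b δ) n' l.reverse m' p' q'` puts `p' = l[|l|-m']`,
`q' = l[|l|-1-m']`; the junction edge is `{q', p'}` = `GateDecomposition`'s `Adj q' p'`, the suffix
`(l.reverse.take m').reverse = l.drop (|l|-m')` starts at `p'` (`w₂ : Walk p' b`),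
`l = l.take m ++ mid ++ l₂` with `mid : q → q'` inside `l.drop m ∩ l.reverse.drop m'`, so the two
no-return clauses of `IsGoodGate` make `mid` avoid `S ∪ T`, as `carvedLaw … (S ∪ T) q q'` says
(order condition `m + m' < |l|`: `gate_index_add_lt`, automatic for non-adjacent level hexagons).

VERDICT: `CarvedToSLE` is correctly stated as the interface between stubs 1/6 and `R6` — no
`stub-misstated`; the stub stays OPEN and, beyond identification proper, must pay (ii).

## Listed, not proved here

* no-bad-edge and `hexDomainSimplyConnected` for the carved set — FALSE in general, see (ii);
* lattice half-ball connectivity (`hlat`) in the six orientations `rowOf k`;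
* the carved marked domain `M = V ∩ V'` (far sides of the two `gateCut`s) as a `DobrushinDomain`
  marked at the gate points, flat of class `k i` in the two `ρ`-balls, containing the carved
  centres, exhausted by `Λ δ`, boundary loop uniformly `o_R(1)`-close to `∂D` (constructors:
  `Newman1939_crosscut_holds`, `IsSimpleArc.exists_periodic_of_union`, `JordanDomain.ofLoop`,
  assembled as in `Literature/…/ArcHullDomains.lean` l. 868);
* uniformity along moving cut domains `M_δ`: `R6` is per FIXED domain with `Λ δ ⊆ D`, so cut levels
  approaching a limit line from OUTSIDE must first be normalised by the exact covariances of
  `hexSAWLaw` (translation by a mesh-lattice vector puts two non-parallel gate lines through `0`;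
  for parallel ones rescale mesh and domain together), then trimmed/sandwiched as in (ii).

Stated over `HexSAW` vocabulary and an abstract row function, independent of the line's definitions
file `…ObservableToSLERGateDefs.lean` (same namespace, no name clash): `carvedWeight Ω δ S u v` IS
`(hexSAWWeight Ω δ u v).restrict {ξ | ∀ x ∈ ξ.walk.support, x ∉ S}`, `carvedLaw` its normalisation,
and `HasCleanWindow` supplies `hwin` with `row := rowOf k`.  Sources: Duminil-Copin–Smirnov,
Ann. of Math. 175 (2012) (arXiv:1007.0575) §1–2, §4; Lawler–Schramm–Werner (2004) §3.4.
-/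

noncomputable section

open scoped BigOperators Topology NNReal ENNReal Classical
open Filter Set MeasureTheory Metric
open Literature.Probability.LatticeModels (HexVertex hexGraph hexCenter triZeta Site)
open Literature.Probability.RandomPlanarGeometry
open Literature.Probability.RandomPlanarGeometry.SAW

namespace Summit.CriticalPhenomena.SAWScalingLimit.Theorems.ObservableToSLER.BridgeGate

/-! ### The carved vertex set of a graph: vertices reachable from the root avoiding `S` -/

section Generic

variable {V : Type*} (G : SimpleGraph V) (S : Set V) (u : V)

/-- The CARVED VERTEX SET of the graph `G` rooted at `u` relative to the removed set `S`: the
vertices `v` joined to `u` by a walk of `G` none of whose vertices lies in `S` (the vertex set of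
the connected component of `u` in `G ∖ S`; empty if `u ∈ S`).  With `G = Ω_δ`
(`hexDomainGraph Ω δ`), `u = q` and `S = U_δ ∪ U'_δ` the two root sides this is the lattice
domain carrying the carved law `carvedLaw Ω δ S q q'` of the line. -/
def carvedVerts : Set V :=
  {v | ∃ p : G.Walk u v, ∀ w ∈ p.support, w ∉ S}

variable {G S u}

/-- The root lies in its carved vertex set as soon as it is not removed. -/
theorem self_mem_carvedVerts (hu : u ∉ S) : u ∈ carvedVerts G S u :=
  ⟨SimpleGraph.Walk.nil, by simpa using hu⟩

/-- Carved vertices are not removed vertices. -/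
theorem not_mem_of_mem_carvedVerts {v : V} (hv : v ∈ carvedVerts G S u) : v ∉ S := by
  obtain ⟨p, hp⟩ := hv
  exact hp v p.end_mem_support

/-- If the root is removed, nothing is carved. -/
theorem carvedVerts_eq_empty (hu : u ∈ S) : carvedVerts G S u = ∅ := by
  ext v
  simp only [carvedVerts, Set.mem_setOf_eq, Set.mem_empty_iff_false, iff_false, not_exists,
    not_forall, not_not]
  exact fun p => ⟨u, p.start_mem_support, hu⟩

/-- Every vertex of an `S`-avoiding walk from the root is carved (cut the walk at that vertex). -/
theorem mem_carvedVerts_of_mem_support {v x : V} (p : G.Walk u v) (hp : ∀ y ∈ p.support, y ∉ S)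
    (hx : x ∈ p.support) : x ∈ carvedVerts G S u :=
  ⟨p.takeUntil x hx, fun y hy => hp y (p.support_takeUntil_subset_support hx hy)⟩

/-- **A walk from the root avoids `S` iff it stays in the carved vertex set.**  This is the
identity behind the dictionary: the `S`-avoiding self-avoiding walks of `G` from `u` (the
support of the carved law) are exactly the self-avoiding walks of `G` inside `carvedVerts`. -/
theorem forall_mem_support_not_mem_iff {v : V} (p : G.Walk u v) :
    (∀ w ∈ p.support, w ∉ S) ↔ ∀ w ∈ p.support, w ∈ carvedVerts G S u :=
  ⟨fun h _ hw => mem_carvedVerts_of_mem_support p h hw,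
    fun h w hw => not_mem_of_mem_carvedVerts (h w hw)⟩

/-- **Re-rooting**: the carved vertex set is the same from every carved vertex (at the target
gate the window lemmas below are applied with root `q'`, carved from `q` by the middle piece). -/
theorem carvedVerts_eq_of_mem {v : V} (hv : v ∈ carvedVerts G S u) :
    carvedVerts G S v = carvedVerts G S u := by
  obtain ⟨p, hp⟩ := hv
  have hp' : ∀ w ∈ p.reverse.support, w ∉ S := fun w hw =>
    hp w (by rwa [SimpleGraph.Walk.support_reverse, List.mem_reverse] at hw)
  ext w
  constructor
  · rintro ⟨r, hr⟩
    refine ⟨p.append r, fun x hx => ?_⟩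
    rw [SimpleGraph.Walk.mem_support_append_iff] at hx
    exact hx.elim (hp x) (hr x)
  · rintro ⟨r, hr⟩
    refine ⟨p.reverse.append r, fun x hx => ?_⟩
    rw [SimpleGraph.Walk.mem_support_append_iff] at hx
    exact hx.elim (hp' x) (hr x)

/-- **The carved vertex set induces a preconnected subgraph** (every carved vertex is joined to
the root inside it) — `R6`'s clause `(hexGraph.induce Λ).Preconnected`, for any graph between
`G` and the ambient lattice. -/
theorem preconnected_induce_carvedVerts {G' : SimpleGraph V} (h : G ≤ G') :
    (G'.induce (carvedVerts G S u)).Preconnected := by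
  by_cases hu : u ∈ S
  · rw [carvedVerts_eq_empty hu]
    exact fun x => x.2.elim
  have hconn : (G.induce (carvedVerts G S u)).Connected := by
    refine SimpleGraph.induce_connected_of_patches u (self_mem_carvedVerts hu) ?_
    intro v hv
    obtain ⟨p, hp⟩ := hv
    refine ⟨{x | x ∈ p.support}, fun x hx => mem_carvedVerts_of_mem_support p hp hx,
      p.start_mem_support, p.end_mem_support, ?_⟩
    exact (p.connected_induce_support).preconnected _ _
  exact hconn.preconnected.mono (SimpleGraph.comap_monotone _ h)

end Generic

/-! ### The carved vertex set of the discrete domain `Ω_δ` -/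

section MeshDomain

variable {V : Type*} {G : SimpleGraph V} {emb : V → ℂ} {Ω : Set ℂ} {δ : ℝ}

/-- **A mesh edge from a vertex of `Ω_δ` to a mesh vertex is an edge of `Ω_δ`**: the far end lies
in the same component of the mesh graph, hence in the discrete domain too (closure of `Ω_δ` under
mesh adjacency, cf. `mem_embMeshDomain_of_adj` of `Literature/…/EmbSAWLawSums.lean`). -/
theorem embDomainGraph_adj_of_mem_of_adj {x y : V} (hx : x ∈ embMeshDomain G emb Ω δ)
    (hxy : (embMeshGraph G emb Ω δ).Adj x y) (hy : y ∈ embMeshVertices emb Ω δ) :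
    (embDomainGraph G emb Ω δ).Adj x y := by
  refine (embDomainGraph_adj_iff G emb).2 ⟨hxy, hx, ?_⟩
  simp only [embMeshDomain, Set.mem_iUnion, Set.mem_image] at hx ⊢
  obtain ⟨C, hC, x', hx', rfl⟩ := hx
  refine ⟨C, hC, ⟨y, hy⟩, ?_, rfl⟩
  rw [SimpleGraph.ConnectedComponent.mem_supp_iff] at hx' ⊢
  rw [← hx']
  exact SimpleGraph.ConnectedComponent.sound
    ⟨SimpleGraph.Walk.cons (SimpleGraph.induce_adj.2 hxy.symm) .nil⟩

/-- The carved vertex set of `Ω_δ` consists of the root and vertices of the discrete domain (a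
carved vertex other than the root carries an edge of `Ω_δ`). -/
theorem carvedVerts_subset_insert {S : Set V} {u : V} :
    carvedVerts (embDomainGraph G emb Ω δ) S u ⊆ insert u (embMeshDomain G emb Ω δ) := by
  rintro v ⟨p, -⟩
  cases hp : p.reverse with
  | nil => exact Set.mem_insert _ _
  | cons hadj _ =>
    exact Set.mem_insert_of_mem _ (ObservableToSLE.FloorRatio.mem_embMeshDomain_of_adj hadj)

/-- **Finiteness**: with finitely many mesh vertices (bounded `Ω`, nonzero mesh: for the honeycomb
lattice `finite_embMeshVertices_hex` of `Theorems/ObservableToSLE/Negative/Identification.lean`)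
the carved vertex set of `Ω_δ` is finite — so it is a `Finset`, as `R6` wants:
`hfin.toFinset`. -/
theorem finite_carvedVerts {S : Set V} {u : V} (hfin : (embMeshVertices emb Ω δ).Finite) :
    (carvedVerts (embDomainGraph G emb Ω δ) S u).Finite :=
  ((hfin.subset (embMeshDomain_subset G emb Ω δ)).insert u).subset carvedVerts_subset_insert

/-- The rescaled positions of the carved vertices lie in `Ω` (given that the root's does) —
`R6`'s clause `∀ v ∈ Λ δ, δ c_v ∈ carrier` for the ambient domain; for the carved continuum
domain it is the crosscut geometry (module docstring, Listed). -/
theorem smul_emb_mem_of_mem_carvedVerts {S : Set V} {u : V} (hu : (δ : ℂ) * emb u ∈ Ω) {v : V}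
    (hv : v ∈ carvedVerts (embDomainGraph G emb Ω δ) S u) : (δ : ℂ) * emb v ∈ Ω := by
  rcases carvedVerts_subset_insert hv with rfl | h
  · exact hu
  · exact embMeshDomain_subset G emb Ω δ h

/-- **The new root is a vertex of `Ω_δ`.**  A vertex read off a walk of `Ω_δ` strictly after its
start (`(support.drop m).head? = some q`, `0 < m`: the exit vertex `q` of `IsFirstExit`) lies in
the discrete domain `embMeshDomain` (hypothesis `hu` of the window lemmas below). -/
theorem mem_embMeshDomain_of_drop_head {a b : V} (w : (embDomainGraph G emb Ω δ).Walk a b)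
    {m : ℕ} {q : V} (hm : 0 < m) (hq : (w.support.drop m).head? = some q) :
    q ∈ embMeshDomain G emb Ω δ := by
  have hmem : q ∈ w.support.drop m := List.mem_of_mem_head? hq
  obtain ⟨k, rfl⟩ : ∃ k, m = 1 + k := ⟨m - 1, by omega⟩
  rw [← List.drop_drop, List.drop_one] at hmem
  have htail : q ∈ w.support.tail := List.mem_of_mem_drop hmem
  rw [← SimpleGraph.Walk.map_snd_darts] at htail
  obtain ⟨d, -, rfl⟩ := List.mem_map.1 htail
  exact ((embDomainGraph_adj_iff G emb).1 d.adj).2.2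

end MeshDomain


/-! ### The clauses of `R6`'s discretisation hypothesis for the carved vertex domain -/

section Clauses

variable {Ω : Set ℂ} {δ : ℝ} {S : Set HexVertex} {Λ : Finset HexVertex} {u : HexVertex}

/-- **`(hexGraph.induce (Λ δ)).Preconnected`** for the carved vertex domain (no hypothesis). -/
theorem preconnected_induce_of_carved
    (hΛ : ∀ w, w ∈ Λ ↔ w ∈ carvedVerts (hexDomainGraph Ω δ) S u) :
    (hexGraph.induce (↑Λ : Set HexVertex)).Preconnected := by
  have hΛset : (↑Λ : Set HexVertex) = carvedVerts (hexDomainGraph Ω δ) S u :=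
    Set.ext fun w => by rw [Finset.mem_coe]; exact hΛ w
  rw [hΛset]
  exact preconnected_induce_carvedVerts (embDomainGraph_le hexGraph hexCenter Ω δ)

/-- **`∀ v ∈ Λ δ, δ c_v ∈ Ω`** for the carved vertex domain of `Ω_δ` (root inside `Ω`).  For the
CARVED continuum domain `M ⊊ Ω` in place of `Ω` this is the crosscut geometry of the line (every
carved vertex lies on the far side of both cuts), not proved here. -/
theorem smul_hexCenter_mem_of_carved
    (hΛ : ∀ w, w ∈ Λ ↔ w ∈ carvedVerts (hexDomainGraph Ω δ) S u)
    (hu : (δ : ℂ) * hexCenter u ∈ Ω) : ∀ w ∈ Λ, (δ : ℂ) * hexCenter w ∈ Ω :=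
  fun w hw => smul_emb_mem_of_mem_carvedVerts hu ((hΛ w).1 hw)

end Clauses

/-! ### The exact half-lattice clause inside a clean window -/

section Window

variable {Ω : Set ℂ} {δ : ℝ} {S T : Set HexVertex} {u p : HexVertex} {c : ℂ} {ρ : ℝ}
  {row : HexVertex → ℤ}

/-- **Window, easy direction.**  If inside the ball `B(c, ρ)` membership in the root side `S` is
exactly the row condition `row · ≤ row p` (the clause of `HasCleanWindow Ω δ ρ S p q` with
`row = rowOf k`, `c = δ c_q`), then every carved vertex in the ball lies on or beyond the row
`row p + 1` of `q`. -/
theorem row_lt_of_mem_carvedVerts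
    (hwin : ∀ x : HexVertex, (δ : ℂ) * hexCenter x ∈ ball c ρ → (x ∈ S ↔ row x ≤ row p))
    {v : HexVertex} (hv : v ∈ carvedVerts (hexDomainGraph Ω δ) (S ∪ T) u)
    (hball : (δ : ℂ) * hexCenter v ∈ ball c ρ) : row p + 1 ≤ row v := by
  have hvS : v ∉ S := fun h => not_mem_of_mem_carvedVerts hv (Or.inl h)
  have := mt (hwin v hball).2 hvS
  omega

/-- **A honeycomb walk inside a ball of `Ω` from a vertex of `Ω_δ` is a walk of `Ω_δ`** (every
step is a mesh edge — the ball is convex — between vertices of the largest component). -/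
theorem exists_walk_of_ball (hΩ : ball c ρ ⊆ Ω) (hu : u ∈ embMeshDomain hexGraph hexCenter Ω δ)
    {v : HexVertex} (w : hexGraph.Walk u v)
    (hw : ∀ x ∈ w.support, (δ : ℂ) * hexCenter x ∈ ball c ρ) :
    ∃ w' : (hexDomainGraph Ω δ).Walk u v, w'.support = w.support := by
  induction w with
  | nil => exact ⟨SimpleGraph.Walk.nil, rfl⟩
  | @cons a b _ hab q ih =>
    have ha : (δ : ℂ) * hexCenter a ∈ ball c ρ := hw a (by simp)
    have hb : (δ : ℂ) * hexCenter b ∈ ball c ρ := hw b (by simp)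
    have hmesh : (embMeshGraph hexGraph hexCenter Ω δ).Adj a b :=
      (embMeshGraph_adj_iff hexGraph hexCenter).2
        ⟨hab, ((convex_ball c ρ).segment_subset ha hb).trans (hΩ.trans subset_closure)⟩
    have hbV : b ∈ embMeshVertices hexCenter Ω δ := hΩ hb
    have hadj := embDomainGraph_adj_of_mem_of_adj hu hmesh hbV
    obtain ⟨w', hw'⟩ := ih ((embDomainGraph_adj_iff hexGraph hexCenter).1 hadj).2.2
      (fun x hx => hw x (by simp [hx]))
    exact ⟨SimpleGraph.Walk.cons hadj w', by rw [SimpleGraph.Walk.support_cons, hw']; rfl⟩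

/-- **Window, hard direction reduced to lattice geometry.**  Inside a clean window (ball in `Ω`,
root side = `{row · ≤ row p}` there, the other root side `T` away from the ball, root `u = q` a
vertex of `Ω_δ`), a vertex `v` of the ball beyond the gate row is carved AS SOON AS the honeycomb
lattice joins `u` to `v` through vertices of the ball beyond the gate row — a statement about the
honeycomb lattice alone ("lattice half-balls are connected"), which is where the six orientations
`rowOf k` enter. -/
theorem mem_carvedVerts_of_window (hΩ : ball c ρ ⊆ Ω)
    (hwin : ∀ x : HexVertex, (δ : ℂ) * hexCenter x ∈ ball c ρ → (x ∈ S ↔ row x ≤ row p))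
    (hT : ∀ x : HexVertex, (δ : ℂ) * hexCenter x ∈ ball c ρ → x ∉ T)
    (hu : u ∈ embMeshDomain hexGraph hexCenter Ω δ) {v : HexVertex}
    (hlat : ∃ w : hexGraph.Walk u v, ∀ x ∈ w.support,
      (δ : ℂ) * hexCenter x ∈ ball c ρ ∧ row p + 1 ≤ row x) :
    v ∈ carvedVerts (hexDomainGraph Ω δ) (S ∪ T) u := by
  obtain ⟨w, hw⟩ := hlat
  obtain ⟨w', hw'⟩ := exists_walk_of_ball hΩ hu w fun x hx => (hw x hx).1
  refine ⟨w', fun x hx => ?_⟩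
  rw [hw'] at hx
  obtain ⟨hxb, hxr⟩ := hw x hx
  rintro (hxS | hxT)
  · have := (hwin x hxb).1 hxS
    omega
  · exact hT x hxb hxT

/-- **THE EXACT HALF-LATTICE CLAUSE OF `R6` IN A CLEAN WINDOW.**  Under the hypotheses of the two
previous lemmas, on any region `W` of the window (e.g. a ball around the gate point of half the
radius) whose vertices beyond the gate row are joined to the root through window vertices beyond
the gate row, membership in the carved vertex set is EXACTLY the signed-row condition
`row p + 1 ≤ row v` — `R6`'s clause `v ∈ Λ δ ↔ m i δ ≤ rowOf (k i) v` with
`m i δ := rowOf (k i) p + 1`, `k i` the orientation of the clean window at gate `i` (at the target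
gate: swap the roles of `S` and `T`, `Set.union_comm`, take `p := p'` and root `q'`, re-rooting by
`carvedVerts_eq_of_mem`). -/
theorem mem_carvedVerts_iff_of_window {W : Set ℂ} (hΩ : ball c ρ ⊆ Ω) (hW : W ⊆ ball c ρ)
    (hwin : ∀ x : HexVertex, (δ : ℂ) * hexCenter x ∈ ball c ρ → (x ∈ S ↔ row x ≤ row p))
    (hT : ∀ x : HexVertex, (δ : ℂ) * hexCenter x ∈ ball c ρ → x ∉ T)
    (hu : u ∈ embMeshDomain hexGraph hexCenter Ω δ)
    (hlat : ∀ v : HexVertex, (δ : ℂ) * hexCenter v ∈ W → row p + 1 ≤ row v →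
      ∃ w : hexGraph.Walk u v, ∀ x ∈ w.support,
        (δ : ℂ) * hexCenter x ∈ ball c ρ ∧ row p + 1 ≤ row x)
    {v : HexVertex} (hv : (δ : ℂ) * hexCenter v ∈ W) :
    v ∈ carvedVerts (hexDomainGraph Ω δ) (S ∪ T) u ↔ row p + 1 ≤ row v :=
  ⟨fun h => row_lt_of_mem_carvedVerts hwin h (hW hv),
    fun hrow => mem_carvedVerts_of_window hΩ hwin hT hu (hlat v hv hrow)⟩

/-- **Registered sub-goal `stub_carvedToSLE_windowClause`** (crux item stmt-CriticalPhenomena-14005,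
line `bridge-gate-renewal`, stub `stub_carvedToSLE`): THE EXACT HALF-LATTICE CLAUSE OF `R6` IN A
CLEAN WINDOW, in registry form with `carvedVerts` unfolded (see `mem_carvedVerts_iff_of_window`). -/
theorem stub_carvedToSLE_windowClause :
    ∀ (Ω : Set ℂ) (δ : ℝ) (S T : Set HexVertex) (u p : HexVertex) (c : ℂ) (ρ : ℝ)
      (row : HexVertex → ℤ) (W : Set ℂ),
      Metric.ball c ρ ⊆ Ω → W ⊆ Metric.ball c ρ →
      (∀ x : HexVertex, (δ : ℂ) * hexCenter x ∈ Metric.ball c ρ → (x ∈ S ↔ row x ≤ row p)) →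
      (∀ x : HexVertex, (δ : ℂ) * hexCenter x ∈ Metric.ball c ρ → x ∉ T) →
      u ∈ embMeshDomain hexGraph hexCenter Ω δ →
      (∀ v : HexVertex, (δ : ℂ) * hexCenter v ∈ W → row p + 1 ≤ row v →
        ∃ w : hexGraph.Walk u v, ∀ x ∈ w.support,
          (δ : ℂ) * hexCenter x ∈ Metric.ball c ρ ∧ row p + 1 ≤ row x) →
      ∀ v : HexVertex, (δ : ℂ) * hexCenter v ∈ W →
        ((∃ π : (hexDomainGraph Ω δ).Walk u v, ∀ x ∈ π.support, x ∉ S ∪ T) ↔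
          row p + 1 ≤ row v) :=
  fun _ _ _ _ _ _ _ _ _ _ hΩ hW hwin hT hu hlat _ hv =>
    mem_carvedVerts_iff_of_window hΩ hW hwin hT hu hlat hv

end Window

end Summit.CriticalPhenomena.SAWScalingLimit.Theorems.ObservableToSLER.BridgeGate

end
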